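import Summits.QuantumAdvantage.AdviceFreeQNC0.AffBells26CubeIdentity
import HarnessLib

/-!
# Q3 of the flip-cube sieve: `AffBells26.SingleSurvivorOf` / `SingleSurvivorCriterion` PROVED (planner qn-p1 g26, ROUND-25 §5; ask P-26 (d))

Prover seat qn-prover-3 g14.  **`singleSurvivorOf : SingleSurvivorOf`** (`CubeConstraint → SingleSurvivorCriterion`) and, with Q2
(`cubeConstraint`), **`singleSurvivorCriterion : SingleSurvivorCriterion`**: if an admissible cube `(x, A)` (`|A| ≥ 2`) has exactly one
surviving row `g`, the fibre of `x` has `≥ 3` coins and `β_g` is non-zero at some coin, then `(β, c)` loses on some odd input — for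
EVERY offset vector `c`.  Consequently (planner's proved glue `noPerfect_of_isolable`) an ISOLABLE matrix `β` is refuted for all `c`.

Proof (the planner's route).  Two-coin flips `x' = flipAt x {k, k'}` stay in the fibre (`Fib19.kline_flipPair`: odd, same kernel line),
so `Admissible`, `Surv`, `D` — which read only ACTIVE bits — are unchanged (`d_flipAt_coins`, `survSum_fibre`), while the lone test moves
by `±β_{g,k} ± β_{g,k'}` (`form_flipAt`).  Q2 at `x` and at every such `x'` forces `form β x' g = c_g + D_g` throughout; with three coins
`i, j, j'` and `β_{g,i} ≠ 0` the three pair moves `{i,j}, {i,j'}, {j,j'}` cannot all vanish (`2a = 0 ⇒ a = 0` in `ZMod 3`).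

WHAT THIS IS NOT: instrument for the (NP₀) rung of crux stmt-QuantumAdvantage-22907 (route DWalkThree); `TwoSurvivorCriterion` and THEOREM
S26 (`CubeRefutableAll`) are NOT proved here; separation NOT moved.
-/

namespace Summit.QuantumAdvantage.AdviceFreeQNC0

namespace AffBells26

open Finset Literature.Computability.QuantumComplexity Literature.Computability.QuantumComplexity.RingHLF
open AffBells23 AffBells24 Fib19

variable {N : ℕ}

/-! ### The cube data are fibre invariants -/

/-- Flipping coins does not change the drifts `d` (they read the ACTIVE bits `a−1`, `a+1`). -/
theorem d_flipAt_coins (β : Fin N → Fin N → ZMod 3) {x : Fin N → Bool} {A : Finset (Fin N)} (hA : Admissible x A)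
    {P : Finset (Fin N)} (hP : ∀ k ∈ P, kline x k = false) (g : Fin N) {a : Fin N} (ha : a ∈ A) :
    d β (flipAt x P) g a = d β x g a := by
  obtain ⟨h1, -, h3⟩ := hA.1 a ha
  have hp : prv a ∉ P := fun h => by rw [hP _ h] at h1; exact Bool.false_ne_true h1
  have hn : nxt a ∉ P := fun h => by rw [hP _ h] at h3; exact Bool.false_ne_true h3
  unfold d
  rw [flipAt_apply_of_not_mem hp, flipAt_apply_of_not_mem hn]

/-- On the fibre the survivors' sum only sees the moved forms. -/
theorem survSum_fibre (β : Fin N → Fin N → ZMod 3) (c : Fin N → ZMod 3) {x : Fin N → Bool} {A : Finset (Fin N)}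
    (hA : Admissible x A) {P : Finset (Fin N)} (hP : ∀ k ∈ P, kline x k = false) (hk : kline (flipAt x P) = kline x) :
    survSum β c (flipAt x P) A =
      ∑ g ∈ Surv β x A, (1 + if form β (flipAt x P) g = c g + D β x A g then 1 else 0) := by
  classical
  have hSurv : Surv β (flipAt x P) A = Surv β x A := by
    unfold Surv
    rw [hk]
    refine filter_congr fun g _ => ?_
    constructor
    · rintro ⟨h1, h2⟩
      exact ⟨h1, fun a ha => by rw [← d_flipAt_coins β hA hP g (mem_of_mem_erase ha)]; exact h2 a ha⟩
    · rintro ⟨h1, h2⟩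
      exact ⟨h1, fun a ha => by rw [d_flipAt_coins β hA hP g (mem_of_mem_erase ha)]; exact h2 a ha⟩
  have hD : ∀ g, D β (flipAt x P) A g = D β x A g := by
    intro g
    unfold D
    exact sum_congr rfl fun a ha => d_flipAt_coins β hA hP g (mem_of_mem_erase ha)
  unfold survSum
  rw [hSurv]
  exact sum_congr rfl fun g _ => by rw [hD g]

/-- With a single survivor `g`, Q2 pins the lone test on the fibre: `form β x' g = c_g + D_g`. -/
theorem form_eq_of_single (hQ2 : CubeConstraint) (hN : 5 ≤ N) (β : Fin N → Fin N → ZMod 3) (c : Fin N → ZMod 3)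
    {x : Fin N → Bool} {A : Finset (Fin N)} {g : Fin N} (hA : Admissible x A) (hcard : 2 ≤ A.card) (hS : Surv β x A = {g})
    (hperf : ∀ x' : Fin N → Bool, IsOdd x' → RingHLF.Rel x' (affBell β c x'))
    {P : Finset (Fin N)} (hP : ∀ k ∈ P, kline x k = false) (hodd' : IsOdd (flipAt x P)) (hk : kline (flipAt x P) = kline x) :
    form β (flipAt x P) g = c g + D β x A g := by
  have hA' : Admissible (flipAt x P) A := by
    unfold Admissible at hA ⊢
    rw [hk]
    exact hA
  have h := hQ2 N hN β c hperf (flipAt x P) A hodd' hA' hcard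
  rw [survSum_fibre β c hA hP hk, hS, sum_singleton] at h
  by_contra hne
  rw [if_neg hne] at h
  norm_num at h

/-! ### Q3 -/

/-- In `ZMod 3`: three pair sums of three numbers cannot all vanish unless the numbers do. -/
theorem zmod3_three_pairs : ∀ a b e : ZMod 3, a + b = 0 → a + e = 0 → b + e = 0 → a = 0 := by
  decide

/-- In `ZMod 3`: a product with a unit vanishes only if the other factor does. -/
theorem zmod3_mul_unit : ∀ b u : ZMod 3, u ≠ 0 → b * u = 0 → b = 0 := by
  decide

/-- **Q3, `SingleSurvivorOf`**: the single-survivor criterion follows from the cube constraint Q2. -/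
theorem singleSurvivorOf : SingleSurvivorOf := by
  classical
  intro hQ2 N hN β c x A g hodd hA hcard hS hZ hi
  obtain ⟨i, hi, hβi⟩ := hi
  by_contra hno
  push Not at hno
  have hperf : ∀ x' : Fin N → Bool, IsOdd x' → RingHLF.Rel x' (affBell β c x') := hno
  -- the lone test is pinned at x and on every two-coin flip of x
  set u : Fin N → ZMod 3 := fun k => β g k * (if x k then 2 else 1) with hu
  have h0 : form β x g = c g + D β x A g := by
    have := form_eq_of_single hQ2 hN β c hA hcard hS hperf (P := ∅) (fun k hk => absurd hk (notMem_empty k))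
      (by rw [flipAt_empty']; exact hodd) (by rw [flipAt_empty'])
    rwa [flipAt_empty'] at this
  have hpair : ∀ k k' : Fin N, k ≠ k' → kline x k = false → kline x k' = false → u k + u k' = 0 := by
    intro k k' hkk hk hk'
    obtain ⟨hodd', hkl⟩ := kline_flipPair (by omega) x hodd hkk hk hk'
    have hP : ∀ m ∈ ({k, k'} : Finset (Fin N)), kline x m = false := by
      intro m hm
      rw [mem_insert, mem_singleton] at hm
      rcases hm with rfl | rfl
      · exact hk
      · exact hk'
    have h1 := form_eq_of_single hQ2 hN β c hA hcard hS hperf hP hodd' hkl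
    rw [form_flipAt, h0, sum_pair hkk] at h1
    have : c g + D β x A g + (u k + u k') = c g + D β x A g + 0 := by rw [add_zero]; exact h1
    exact add_left_cancel this
  -- three coins: i (with β g i ≠ 0) and two more
  have hcoins : 1 < ((univ.filter fun m : Fin N => kline x m = false).erase i).card := by
    rw [card_erase_of_mem (by rw [mem_filter]; exact ⟨mem_univ _, hi⟩)]
    unfold zeros at hZ
    omega
  obtain ⟨j, hj, j', hj', hjj⟩ := one_lt_card.1 hcoins
  rw [mem_erase, mem_filter] at hj hj'
  have e1 := hpair i j (Ne.symm hj.1) hi hj.2.2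
  have e2 := hpair i j' (Ne.symm hj'.1) hi hj'.2.2
  have e3 := hpair j j' hjj hj.2.2 hj'.2.2
  have hui : u i = 0 := zmod3_three_pairs (u i) (u j) (u j') e1 e2 e3
  have hunit : (if x i then (2 : ZMod 3) else 1) ≠ 0 := by
    cases x i <;> decide
  exact hβi (zmod3_mul_unit (β g i) _ hunit hui)

/-- **Q3, `SingleSurvivorCriterion`** — unconditionally, from Q2 (`cubeConstraint`). -/
theorem singleSurvivorCriterion : SingleSurvivorCriterion := singleSurvivorOf cubeConstraint

/-- Corollary (planner's glue `noPerfect_of_isolable`): an isolable matrix loses for every offset vector. -/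
theorem noPerfect_of_isolable' {N : ℕ} (hN : 5 ≤ N) (β : Fin N → Fin N → ZMod 3) (hβ : Isolable β)
    (c : Fin N → ZMod 3) : ∃ x : Fin N → Bool, IsOdd x ∧ ¬ RingHLF.Rel x (affBell β c x) :=
  noPerfect_of_isolable singleSurvivorCriterion hN β hβ c

end AffBells26

end Summit.QuantumAdvantage.AdviceFreeQNC0
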